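import Literature.AlgebraicGeometry.Motives.UniversalHyperplaneSectionChart
import Literature.AlgebraicGeometry.Motives.UniversalHyperplaneSectionFamilyFlat
import Literature.AlgebraicGeometry.Motives.ProjectiveSpaceFieldPointsBijective
import Literature.AlgebraicGeometry.Motives.SegrePowers
import Literature.AlgebraicGeometry.Motives.VarietiesGeometricallyIntegralProofs
import Literature.AlgebraicGeometry.HodgeTheory.VanishingCohomologyNontrivial
import Literature.AlgebraicGeometry.HodgeTheory.IncidenceDivisorDescent
import HarnessLib

/-!
# The fibre of the universal hyperplane section over `[a]` is the hyperplane section `X ∩ V₊(ℓ_a)`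

Topic `Literature/AlgebraicGeometry/Motives` (theorems only; no definitions, no named facts). For a
projective embedding `e : X ↪ ℙᴺ_ℂ` the tree carries TWO avatars of the hyperplane section of `X` by
the hyperplane `H_a = V₊(ℓ_a)`, `ℓ_a = Σᵢ aᵢ xᵢ`:

* the FIBRE `fiberOver (proj N e.ι) [a]` of the universal hyperplane section
  `π = pr₂ : 𝒳 = {(x, b) | Σ bᵢ xᵢ(x) = 0} ⟶ (ℙᴺ)^*` (`Motives/UniversalHyperplaneSection`, the
  REDUCED closed subscheme of `X × (ℙᴺ)^*` on the incidence locus) over the point `[a]` — the currency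
  of the monodromy, good-locus and Lefschetz-pencil packages (`HodgeTheory.smoothFiberLocus`, …);
* the ZERO SCHEME `e.hypersurfaceSection (linForm N a) _ = V(ℓ_a(s₀, …, s_N)) ⊆ X` of the section
  `ℓ_a(s)` of `𝒪_X(1)` (`HodgeTheory/VanishingCohomologyNontrivial`, `Motives/SecZeroScheme`).

This file identifies them:

* `pull_chartSectionι_incidenceFun` — the incidence function `g = Σᵢ uᵢ ⊗ vᵢ` vanishes on the piece
  of `𝒳` over each affine chart (it vanishes on its points and `𝒳` is reduced);
* `exists_hom_fiberOver_proj_hypersurfaceSection` — **`π⁻¹[a] ⟶ X ∩ V₊(ℓ_a)` over `X`**: the zero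
  scheme ideal of `ℓ_a(s)` is contained in the kernel of `π⁻¹[a] ⟶ X` (on the chart `X_{x_j}` the
  generator `ℓ_a(s)/s_j = Σᵢ aᵢ uᵢ` pulls back to `a_l · g|_{b = a} = 0`), so the universal property of
  the closed immersion `X ∩ V₊(ℓ_a) ↪ X` applies;
* `range_map_fiberι_proj_toX_eq` — both avatars have the same complex points in `X`
  (`{x | ℓ_a(e(x)) = 0}`);
* `exists_iso_fiberOver_proj_hypersurfaceSection` — **if `X ∩ V₊(ℓ_a)` is reduced (e.g. smooth) the
  morphism is an isomorphism over `X`** (a surjective closed immersion onto a reduced scheme), and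
  `isSmoothProjective_fiberOver_proj_of_hypersurfaceSection` — so smoothness / projectivity /
  irreducibility of `X ∩ V₊(ℓ_a)` is that of the fibre `π⁻¹[a]`.

## References

* [VoisinHodgeII2003] C. Voisin, Hodge Theory and Complex Algebraic Geometry II, CUP 2003, §2.1.1,
  §2.3.1 ("each hypersurface `X_t` can be naturally identified with the fibre"), §3.2.2.
* [GortzWedhorn2020] U. Görtz, T. Wedhorn, Algebraic Geometry I, 2nd ed. (2020), (13.13) pp. 504–505.
* [Hartshorne1977] R. Hartshorne, Algebraic Geometry, II Prop. 2.5, II Example 3.2.6, II Thm. 7.1.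
-/

noncomputable section

open CategoryTheory CategoryTheory.Limits AlgebraicGeometry TopologicalSpace MonoidalCategory
  CartesianMonoidalCategory HomogeneousLocalization TensorProduct
open Literature.AlgebraicGeometry.HodgeTheory

universe u

namespace Literature.AlgebraicGeometry.Motives

attribute [local instance] MvPolynomial.gradedAlgebra

namespace UniversalHyperplaneSection

/-! ### The incidence function vanishes on the universal hyperplane section -/

section Vanishing

variable {k : Type u} [Field k] {N : ℕ} {X : SchemeOver k} (ι : X ⟶ projectiveSpace N k)
  (j l : Fin (N + 1)) (X' : X.left.affineOpens)

/-- **The incidence function `g = Σᵢ uᵢ ⊗ vᵢ` vanishes on `𝒳 ∩ (X' × D₊(a_l))`**: its pull-back along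
the closed immersion `𝒳 ∩ (X' × D₊(a_l)) ↪ Spec (Γ(X, X') ⊗ (k[a]_{(a_l)})₀)` is zero, because that
scheme is reduced and its image is the zero locus of `g` (`range_chartSectionι`).
[cite: VoisinHodgeII2003, §3.2.2] [cite: Hartshorne1977, II Example 3.2.6] -/
theorem pull_chartSectionι_incidenceFun
    (hX' : (X' : X.left.Opens) ≤ ι.left ⁻¹ᵁ Proj.basicOpen (Segre.grading (Fin (N + 1)) k) (MvPolynomial.X j)) :
    Segre.pull (chartSectionι ι l X') (incidenceFun ι j l X' hX') = 0 := by
  rw [← basicOpen_eq_bot_iff, Segre.basicOpen_pull]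
  ext x
  simp only [Opens.coe_bot, Set.mem_empty_iff_false, iff_false]
  intro hx
  have hmem : chartSectionι ι l X' x ∈ Set.range (chartSectionι ι l X') := ⟨x, rfl⟩
  rw [range_chartSectionι ι j l X' hX'] at hmem
  have hg : incidenceFun ι j l X' hX' ∈ (chartSectionι ι l X' x).asIdeal := by
    have := (PrimeSpectrum.mem_zeroLocus _ _).mp hmem
    exact this (Set.mem_singleton _)
  exact hx hg

end Vanishing

/-! ### The point `[a]` and the fibre `π⁻¹[a]` -/

section Point

attribute [local instance] ProjBaseChange.algebraBase

variable {N : ℕ}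

/-- Every morphism into `specOver ℂ ℂ` over `ℂ` is the structure morphism (`specOver ℂ ℂ` is terminal;
cf. `Motives.eq_toSpecOver` of `Motives/JacobianAlbanese`, not imported here). [folklore] -/
private theorem eq_toSpecOver_of_hom {Y : SchemeOver ℂ} (g : Y ⟶ specOver ℂ ℂ) : g = toSpecOver Y := by
  apply Over.OverMorphism.ext
  rw [toSpecOver_left, ← Over.w g]
  simp only [specOver, Over.mk_hom, Algebra.algebraMap_self, CommRingCat.ofHom_id, Spec.map_id]
  exact (Category.comp_id _).symm

/-- The underlying map of a complex point `Spec ℂ ⟶ T` has range `{pt t}`. [folklore] -/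
private theorem range_left_base_complexPoint {T : SchemeOver ℂ} (t : ComplexPoints T) :
    Set.range t.left.base = {t.pt} := by
  haveI : Unique ↥(specOver ℂ ℂ).left := inferInstanceAs (Unique (PrimeSpectrum ℂ))
  rw [Set.range_eq_singleton]
  exact fun x => congr(t.left.base $(Subsingleton.elim x _))

/-- **The point `[a] ∈ (ℙᴺ)^*(ℂ)` factors through the chart `D₊(b_l)`** (`a_l ≠ 0`): its underlying
morphism is `Spec` of a ring map `ev : (ℂ[b]_{(b_l)})₀ → ℂ` with `ev (b_i/b_l) = a_i/a_l` (the evaluation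
at `a`, `ProjectiveSpace.awayEval`), followed by `D₊(b_l) ↪ (ℙᴺ)^*`. [cite: Hartshorne1977, II Prop. 2.5] -/
theorem exists_pointOfVec_left_eq_chart (a : Fin (N + 1) → ℂ) (ha : a ≠ 0) (l : Fin (N + 1)) (hl : a l ≠ 0) :
    ∃ ev : chartBaseRing (k := ℂ) N l →+* ℂ,
      (ProjectiveSpace.pointOfVec ℂ a ha).left = Spec.map (CommRingCat.ofHom ev) ≫ chartBaseι N l ∧
      ∀ i, ev (Segre.frac ℂ l i) = a i / a l := by
  refine ⟨(ProjectiveSpace.awayEval a (ProjectiveSpace.aeval_X_ne_zero hl)).toRingHom, ?_, fun i => ?_⟩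
  · rw [ProjectiveSpace.pointOfVec_eq_chartPoint a ha (Segre.X_mem ℂ l) zero_lt_one
      (ProjectiveSpace.aeval_X_ne_zero hl), ProjectiveSpace.chartPoint_left]
    rfl
  · change ProjectiveSpace.awayEval a _ (Segre.frac ℂ l i) = _
    rw [Segre.frac, Away.isLocalizationElem, ProjectiveSpace.awayEval_mk, pow_one, pow_one,
      MvPolynomial.aeval_X, MvPolynomial.aeval_X]

end Point

/-- Global sections of a restricted morphism: `(f ∣_ U)^*` on `Γ(U, ⊤) = Γ(Y, U)` is `f^* : Γ(Y, U) →
Γ(X, f⁻¹U) = Γ(f⁻¹U, ⊤)` (Mathlib `Scheme.Hom.resLE_app_top`). [folklore] -/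
private theorem morphismRestrict_appTop_apply {Y Z : Scheme.{u}} (f : Y ⟶ Z) (U : Z.Opens) (s : Γ(↑U, ⊤)) :
    (f ∣_ U).appTop s = (f ⁻¹ᵁ U).topIso.inv (f.app U (U.topIso.hom s)) := by
  have h : (f ∣_ U).appTop = U.topIso.hom ≫ f.app U ≫ (f ⁻¹ᵁ U).topIso.inv := by
    rw [← Scheme.Hom.resLE_eq_morphismRestrict, Scheme.Hom.appTop, Scheme.Hom.resLE_app_top,
      ← Scheme.Hom.app_eq_appLE]
  rw [h]
  rfl

/-! ### The morphism `π⁻¹[a] ⟶ X ∩ V₊(ℓ_a)`: the zero-scheme ideal dies on the fibre -/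

section Fibre

attribute [local instance] chartBaseRingAlgebra sectionsAlgebra

variable {X : SchemeOver ℂ} (e : ProjectiveEmbedding X) (a : Fin (e.n + 1) → ℂ) (ha : a ≠ 0)

/-- Every point of `π⁻¹[a]` maps to `[a]` under `π⁻¹[a] ⟶ 𝒳 ⟶ (ℙᴺ)^*`. [folklore] -/
private theorem proj_fiberι_apply (y : ↥(fiberOver (proj e.n e.ι) (ProjectiveSpace.pointOfVec ℂ a ha)).left) :
    (proj e.n e.ι).left.base ((fiberι (proj e.n e.ι) (ProjectiveSpace.pointOfVec ℂ a ha)).left.base y) =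
      (ProjectiveSpace.pointOfVec ℂ a ha).pt := by
  have h := congrArg (fun φ => φ.left.base y) (fiberι_comp (proj e.n e.ι) (ProjectiveSpace.pointOfVec ℂ a ha))
  simp only [Over.comp_left, Scheme.Hom.comp_base, TopCat.coe_comp, Function.comp_apply] at h
  rw [h]
  have hmem : (ProjectiveSpace.pointOfVec ℂ a ha).left.base
      ((fiberOverToSpec (proj e.n e.ι) (ProjectiveSpace.pointOfVec ℂ a ha)).left.base y) ∈
      Set.range (ProjectiveSpace.pointOfVec ℂ a ha).left.base := ⟨_, rfl⟩
  rw [range_left_base_complexPoint] at hmem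
  exact hmem

/-- Notation-free abbreviation: the grading of `ℂ[x₀, …, x_N]`. -/
local notation "𝒜ₑ" => Segre.grading (Fin (e.n + 1)) ℂ

/-- **The piece of `π⁻¹[a]` over an affine open `X' ⊆ X_{x_j}` maps into the chart `X' × D₊(b_l)` of
`X × (ℙᴺ)^*` (`a_l ≠ 0`) through the piece `𝒳 ∩ (X' × D₊(b_l))` of the universal hyperplane
section**: there is a lift `χ` to the chart, compatible with the two projections, along which the
incidence function `g = Σᵢ uᵢ ⊗ vᵢ` pulls back to zero. [cite: VoisinHodgeII2003, §3.2.2] -/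
theorem exists_chartLift_fiberOver_proj (j l : Fin (e.n + 1)) (hl : a l ≠ 0) (X' : X.left.affineOpens)
    (hX' : (X' : X.left.Opens) ≤ e.toProj ⁻¹ᵁ Proj.basicOpen 𝒜ₑ (MvPolynomial.X j)) :
    ∃ χ : (((fiberι (proj e.n e.ι) (ProjectiveSpace.pointOfVec ℂ a ha) ≫ toX e.n e.ι).left ⁻¹ᵁ
          (X' : X.left.Opens) : (fiberOver (proj e.n e.ι)
            (ProjectiveSpace.pointOfVec ℂ a ha)).left.Opens) : Scheme.{0}) ⟶
        Spec (.of (chartRing (X := X) l X')),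
      χ ≫ chartImm X l X' ≫ pullback.fst X.hom (dualProjectiveSpace e.n ℂ).hom =
        ((fiberι (proj e.n e.ι) (ProjectiveSpace.pointOfVec ℂ a ha) ≫ toX e.n e.ι).left ⁻¹ᵁ
          (X' : X.left.Opens)).ι ≫ (fiberι (proj e.n e.ι) (ProjectiveSpace.pointOfVec ℂ a ha) ≫ toX e.n e.ι).left ∧
      χ ≫ chartImm X l X' ≫ pullback.snd X.hom (dualProjectiveSpace e.n ℂ).hom =
        ((fiberι (proj e.n e.ι) (ProjectiveSpace.pointOfVec ℂ a ha) ≫ toX e.n e.ι).left ⁻¹ᵁ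
          (X' : X.left.Opens)).ι ≫ (fiberι (proj e.n e.ι) (ProjectiveSpace.pointOfVec ℂ a ha)).left ≫
            (proj e.n e.ι).left ∧
      Segre.pull χ (incidenceFun e.ι j l X' hX') = 0 := by
  -- the two projections of `ψ = (piece ⟶ π⁻¹[a] ⟶ 𝒳 ⟶ X × (ℙᴺ)^*)`
  have h1 : (((fiberι (proj e.n e.ι) (ProjectiveSpace.pointOfVec ℂ a ha) ≫ toX e.n e.ι).left ⁻¹ᵁ
        (X' : X.left.Opens)).ι ≫
        (fiberι (proj e.n e.ι) (ProjectiveSpace.pointOfVec ℂ a ha)).left ≫ (emb e.n e.ι).left) ≫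
        pullback.fst X.hom (dualProjectiveSpace e.n ℂ).hom =
      ((fiberι (proj e.n e.ι) (ProjectiveSpace.pointOfVec ℂ a ha) ≫ toX e.n e.ι).left ⁻¹ᵁ
        (X' : X.left.Opens)).ι ≫ (fiberι (proj e.n e.ι) (ProjectiveSpace.pointOfVec ℂ a ha) ≫ toX e.n e.ι).left := by
    simp only [Category.assoc]
    rfl
  have h2 : (((fiberι (proj e.n e.ι) (ProjectiveSpace.pointOfVec ℂ a ha) ≫ toX e.n e.ι).left ⁻¹ᵁ
        (X' : X.left.Opens)).ι ≫
        (fiberι (proj e.n e.ι) (ProjectiveSpace.pointOfVec ℂ a ha)).left ≫ (emb e.n e.ι).left) ≫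
        pullback.snd X.hom (dualProjectiveSpace e.n ℂ).hom =
      (((fiberι (proj e.n e.ι) (ProjectiveSpace.pointOfVec ℂ a ha) ≫ toX e.n e.ι).left ⁻¹ᵁ
        (X' : X.left.Opens)).ι ≫ (fiberι (proj e.n e.ι) (ProjectiveSpace.pointOfVec ℂ a ha)).left) ≫
        (proj e.n e.ι).left := by
    simp only [Category.assoc]
    rfl
  -- the image of `ψ` lies in the chart `X' × D₊(b_l)`
  have hrange : Set.range (((fiberι (proj e.n e.ι) (ProjectiveSpace.pointOfVec ℂ a ha) ≫ toX e.n e.ι).left ⁻¹ᵁ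
          (X' : X.left.Opens)).ι ≫
          (fiberι (proj e.n e.ι) (ProjectiveSpace.pointOfVec ℂ a ha)).left ≫ (emb e.n e.ι).left) ⊆
      Set.range (chartImm X l X') := by
    rintro _ ⟨y, rfl⟩
    have hr := Set.ext_iff.mp (range_chartImm (X := X) l X')
    refine (hr _).2 ⟨?_, ?_⟩
    · have h1y := congrArg (fun φ => φ.base y) h1
      simp only [Scheme.Hom.comp_base, TopCat.comp_app] at h1y
      change _ ∈ ((X' : X.left.Opens) : Set X.left)
      erw [h1y]
      exact y.2
    · have h2y := congrArg (fun φ => φ.base y) h2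
      simp only [Scheme.Hom.comp_base, TopCat.comp_app] at h2y
      change _ ∈ ((Proj.basicOpen 𝒜ₑ (MvPolynomial.X l) : (Proj 𝒜ₑ).Opens) : Set (Proj 𝒜ₑ))
      erw [h2y, proj_fiberι_apply]
      exact (ProjectiveSpace.pt_pointOfVec_mem_basicOpen_X_iff a ha l).2 hl
  have hfac := IsOpenImmersion.lift_fac (chartImm X l X') _ hrange
  refine ⟨IsOpenImmersion.lift (chartImm X l X') _ hrange, ?_, ?_, ?_⟩
  · rw [← Category.assoc, hfac]
    exact h1
  · rw [← Category.assoc, hfac]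
    exact h2.trans (Category.assoc _ _ _)
  -- the lift factors through `𝒳 ∩ (X' × D₊(b_l))`, on which `g` vanishes
  let χ' : (((fiberι (proj e.n e.ι) (ProjectiveSpace.pointOfVec ℂ a ha) ≫ toX e.n e.ι).left ⁻¹ᵁ
      (X' : X.left.Opens) : (fiberOver (proj e.n e.ι) (ProjectiveSpace.pointOfVec ℂ a ha)).left.Opens) :
        Scheme.{0}) ⟶ chartSection X e.ι l X' :=
    pullback.lift (((fiberι (proj e.n e.ι) (ProjectiveSpace.pointOfVec ℂ a ha) ≫ toX e.n e.ι).left ⁻¹ᵁ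
        (X' : X.left.Opens)).ι ≫ (fiberι (proj e.n e.ι) (ProjectiveSpace.pointOfVec ℂ a ha)).left)
      (IsOpenImmersion.lift (chartImm X l X') _ hrange) (by rw [Category.assoc]; exact hfac.symm)
  have hχ' : χ' ≫ chartSectionι e.ι l X' = IsOpenImmersion.lift (chartImm X l X') _ hrange :=
    pullback.lift_snd _ _ _
  rw [← hχ', Segre.pull_comp, RingHom.comp_apply, pull_chartSectionι_incidenceFun, map_zero]

/-- In the situation of `exists_chartLift_fiberOver_proj`: a chart lift compatible with the first
projection, followed by the Segre chart map `chartα` (to `D₊(x_j)`), is the restriction of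
`π⁻¹[a] ⟶ X` over `X'` followed by the chart map `X' ⊆ X_{x_j} ⟶ D₊(x_j)` of `e`. [cite: VoisinHodgeII2003, §3.2.2] -/
theorem chartLift_chartα_eq (j l : Fin (e.n + 1)) (X' : X.left.affineOpens)
    (hX' : (X' : X.left.Opens) ≤ e.toProj ⁻¹ᵁ Proj.basicOpen 𝒜ₑ (MvPolynomial.X j))
    (χ : (((fiberι (proj e.n e.ι) (ProjectiveSpace.pointOfVec ℂ a ha) ≫ toX e.n e.ι).left ⁻¹ᵁ
          (X' : X.left.Opens) : (fiberOver (proj e.n e.ι)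
            (ProjectiveSpace.pointOfVec ℂ a ha)).left.Opens) : Scheme.{0}) ⟶
        Spec (.of (chartRing (X := X) l X')))
    (hχ : χ ≫ chartImm X l X' ≫ pullback.fst X.hom (dualProjectiveSpace e.n ℂ).hom =
        ((fiberι (proj e.n e.ι) (ProjectiveSpace.pointOfVec ℂ a ha) ≫ toX e.n e.ι).left ⁻¹ᵁ
          (X' : X.left.Opens)).ι ≫ (fiberι (proj e.n e.ι) (ProjectiveSpace.pointOfVec ℂ a ha) ≫ toX e.n e.ι).left) :
    χ ≫ chartα e.ι j l X' hX' =
      ((fiberι (proj e.n e.ι) (ProjectiveSpace.pointOfVec ℂ a ha) ≫ toX e.n e.ι).left ∣_ (X' : X.left.Opens)) ≫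
        X.left.homOfLE hX' ≫ GeneratingSections.chartLift e.toProj j := by
  rw [← cancel_mono (Segre.chartι ℂ j)]
  have hχ' := congrArg (· ≫ e.ι.left) hχ
  simp only [Category.assoc] at hχ'
  rw [Category.assoc, ← specMap_fromSpec_ι e.ι j l X' hX', ← chartImm_fst_assoc, Category.assoc,
    Category.assoc, GeneratingSections.chartLift_chartι, Scheme.homOfLE_ι_assoc, morphismRestrict_ι_assoc]
  exact hχ'

/-- In the situation of `exists_chartLift_fiberOver_proj`: a chart lift compatible with the second
projection, followed by the Segre chart map `chartβ` (to `D₊(b_l)`), is the constant map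
`π⁻¹[a] ⟶ Spec ℂ ⟶ D₊(b_l)` at `[a]`, for any factorisation `[a] = Spec ev ≫ (D₊(b_l) ↪ (ℙᴺ)^*)`.
[cite: VoisinHodgeII2003, §3.2.2] -/
theorem chartLift_chartβ_eq (l : Fin (e.n + 1)) (X' : X.left.affineOpens)
    (ev : chartBaseRing (k := ℂ) e.n l →+* ℂ)
    (hev : (ProjectiveSpace.pointOfVec ℂ a ha).left = Spec.map (CommRingCat.ofHom ev) ≫ chartBaseι e.n l)
    (χ : (((fiberι (proj e.n e.ι) (ProjectiveSpace.pointOfVec ℂ a ha) ≫ toX e.n e.ι).left ⁻¹ᵁ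
          (X' : X.left.Opens) : (fiberOver (proj e.n e.ι)
            (ProjectiveSpace.pointOfVec ℂ a ha)).left.Opens) : Scheme.{0}) ⟶
        Spec (.of (chartRing (X := X) l X')))
    (hχ : χ ≫ chartImm X l X' ≫ pullback.snd X.hom (dualProjectiveSpace e.n ℂ).hom =
        ((fiberι (proj e.n e.ι) (ProjectiveSpace.pointOfVec ℂ a ha) ≫ toX e.n e.ι).left ⁻¹ᵁ
          (X' : X.left.Opens)).ι ≫ (fiberι (proj e.n e.ι) (ProjectiveSpace.pointOfVec ℂ a ha)).left ≫
            (proj e.n e.ι).left) :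
    χ ≫ chartβ l X' =
      (((fiberι (proj e.n e.ι) (ProjectiveSpace.pointOfVec ℂ a ha) ≫ toX e.n e.ι).left ⁻¹ᵁ
          (X' : X.left.Opens)).ι ≫
        (fiberOverToSpec (proj e.n e.ι) (ProjectiveSpace.pointOfVec ℂ a ha)).left) ≫
        Spec.map (CommRingCat.ofHom ev) := by
  have hπ : (fiberι (proj e.n e.ι) (ProjectiveSpace.pointOfVec ℂ a ha)).left ≫ (proj e.n e.ι).left =
      (fiberOverToSpec (proj e.n e.ι) (ProjectiveSpace.pointOfVec ℂ a ha)).left ≫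
        (ProjectiveSpace.pointOfVec ℂ a ha).left := by
    have h := congrArg Over.Hom.left (fiberι_comp (proj e.n e.ι) (ProjectiveSpace.pointOfVec ℂ a ha))
    simp only [Over.comp_left] at h
    exact h
  rw [← cancel_mono (chartBaseι e.n l), Category.assoc, ← chartImm_snd]
  refine hχ.trans ?_
  rw [hπ]
  simp only [Category.assoc]
  exact congrArg (fun φ => ((fiberι (proj e.n e.ι) (ProjectiveSpace.pointOfVec ℂ a ha) ≫ toX e.n e.ι).left ⁻¹ᵁ
    (X' : X.left.Opens)).ι ≫ (fiberOverToSpec (proj e.n e.ι) (ProjectiveSpace.pointOfVec ℂ a ha)).left ≫ φ) hev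


set_option synthInstance.maxHeartbeats 200000 in
set_option maxHeartbeats 800000 in
/-- **The chart computation.** For an affine open `X' ⊆ X_{x_j}`, the dehomogenised linear form
`ℓ_a/x_j ∈ (ℂ[x]_{(x_j)})₀`, pulled back along the chart map `X' ⟶ D₊(x_j)` of `e` and then along the
restriction of `π⁻¹[a] ⟶ X` over `X'`, vanishes: in the chart `X' × D₊(b_l)` (`a_l ≠ 0`) one has
`ℓ_a/x_j = Σᵢ aᵢ uᵢ = a_l · g|_{b = a}` with `g = Σᵢ uᵢ ⊗ vᵢ` the incidence function, which dies on `𝒳`.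
[cite: VoisinHodgeII2003, §3.2.2] [cite: GortzWedhorn2020, Section (13.13)] -/
theorem appTop_restrict_pull_chartLift_linForm (j : Fin (e.n + 1)) (X' : X.left.affineOpens)
    (hX' : (X' : X.left.Opens) ≤ e.toProj ⁻¹ᵁ Proj.basicOpen 𝒜ₑ (MvPolynomial.X j))
    (hmem : linForm e.n a ∈ 𝒜ₑ (1 • 1)) :
    ((fiberι (proj e.n e.ι) (ProjectiveSpace.pointOfVec ℂ a ha) ≫ toX e.n e.ι).left ∣_ (X' : X.left.Opens)).appTop
      (Segre.pull (X.left.homOfLE hX' ≫ GeneratingSections.chartLift e.toProj j)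
        (Away.mk 𝒜ₑ (Segre.X_mem ℂ j) 1 (linForm e.n a) hmem)) = 0 := by
  obtain ⟨l, hl⟩ : ∃ l, a l ≠ 0 := Function.ne_iff.mp ha
  obtain ⟨ev, hev, hev_frac⟩ := exists_pointOfVec_left_eq_chart a ha l hl
  obtain ⟨χ, hχ₁, hχ₂, hχ0⟩ := exists_chartLift_fiberOver_proj e a ha j l hl X' hX'
  have hB := chartLift_chartα_eq e a ha j l X' hX' χ hχ₁
  have hC := chartLift_chartβ_eq e a ha l X' ev hev χ hχ₂
  -- the constants: `ρ (cst c) = κ c` for `ρ = pull (χ ≫ chartα)` and `κ` the structure map of the piece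
  have hcst : ∀ c : ℂ, Segre.pull (χ ≫ chartα e.ι j l X' hX') (Segre.cst ℂ (MvPolynomial.X j) c) =
      Segre.pull (((fiberι (proj e.n e.ι) (ProjectiveSpace.pointOfVec ℂ a ha) ≫ toX e.n e.ι).left ⁻¹ᵁ
          (X' : X.left.Opens)).ι ≫
        (fiberOverToSpec (proj e.n e.ι) (ProjectiveSpace.pointOfVec ℂ a ha)).left) c := by
    intro c
    have hmor : (χ ≫ chartα e.ι j l X' hX') ≫ Spec.map (CommRingCat.ofHom (Segre.cst ℂ (MvPolynomial.X j))) =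
        (((fiberι (proj e.n e.ι) (ProjectiveSpace.pointOfVec ℂ a ha) ≫ toX e.n e.ι).left ⁻¹ᵁ
          (X' : X.left.Opens)).ι ≫
          (fiberOverToSpec (proj e.n e.ι) (ProjectiveSpace.pointOfVec ℂ a ha)).left) ≫
          Spec.map (CommRingCat.ofHom (algebraMap ℂ ℂ)) := by
      rw [hB, Category.assoc, Category.assoc,
        GeneratingSections.chartLift_SpecMap_cst X.hom e.toProj (toProj_toSpec e) j,
        Scheme.homOfLE_ι_assoc, morphismRestrict_ι_assoc, Category.assoc]
      have hw : ((fiberι (proj e.n e.ι) (ProjectiveSpace.pointOfVec ℂ a ha) ≫ toX e.n e.ι)).left ≫ X.hom =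
          (fiberOverToSpec (proj e.n e.ι) (ProjectiveSpace.pointOfVec ℂ a ha)).left ≫ (specOver ℂ ℂ).hom := by
        rw [Over.w, Over.w]
      rw [hw]
      rfl
    have h := congrArg (fun φ => Segre.pull φ c) hmor
    dsimp only at h
    rw [Segre.pull_SpecMap] at h
    have h2 := Segre.pull_SpecMap (((fiberι (proj e.n e.ι) (ProjectiveSpace.pointOfVec ℂ a ha) ≫ toX e.n e.ι).left ⁻¹ᵁ
        (X' : X.left.Opens)).ι ≫ (fiberOverToSpec (proj e.n e.ι) (ProjectiveSpace.pointOfVec ℂ a ha)).left)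
      (CommRingCat.ofHom (algebraMap ℂ ℂ)) c
    have h3 : (ConcreteCategory.hom (CommRingCat.ofHom (algebraMap ℂ ℂ))) c = c := rfl
    rw [h3] at h2
    exact h.trans h2
  -- the coordinates: `ρ (x_i/x_j) = pull χ (uᵢ ⊗ 1)` and `pull χ (1 ⊗ vᵢ) = κ (aᵢ/a_l)`
  have hu : ∀ i, Segre.pull χ (secCoord e.ι j X' hX' i ⊗ₜ[ℂ] (1 : chartBaseRing e.n l)) =
      Segre.pull (χ ≫ chartα e.ι j l X' hX') (Segre.frac ℂ j i) := by
    intro i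
    rw [Segre.pull_comp, RingHom.comp_apply, pull_chartα_frac]
    rfl
  have hv : ∀ i, Segre.pull χ ((1 : Γ(X.left, (X' : X.left.Opens))) ⊗ₜ[ℂ] Segre.frac ℂ l i) =
      Segre.pull (((fiberι (proj e.n e.ι) (ProjectiveSpace.pointOfVec ℂ a ha) ≫ toX e.n e.ι).left ⁻¹ᵁ
          (X' : X.left.Opens)).ι ≫
        (fiberOverToSpec (proj e.n e.ι) (ProjectiveSpace.pointOfVec ℂ a ha)).left) (a i / a l) := by
    intro i
    have h1 : Segre.pull χ ((1 : Γ(X.left, (X' : X.left.Opens))) ⊗ₜ[ℂ] Segre.frac ℂ l i) =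
        Segre.pull (χ ≫ chartβ l X') (Segre.frac ℂ l i) := by
      rw [Segre.pull_comp, RingHom.comp_apply, pull_chartβ_frac]
      rfl
    rw [h1, hC]
    have h2 := Segre.pull_SpecMap (((fiberι (proj e.n e.ι) (ProjectiveSpace.pointOfVec ℂ a ha) ≫ toX e.n e.ι).left ⁻¹ᵁ
        (X' : X.left.Opens)).ι ≫ (fiberOverToSpec (proj e.n e.ι) (ProjectiveSpace.pointOfVec ℂ a ha)).left)
      (CommRingCat.ofHom ev) (Segre.frac ℂ l i)
    have h3 : (ConcreteCategory.hom (CommRingCat.ofHom ev)) (Segre.frac ℂ l i) = a i / a l := hev_frac i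
    rw [h3] at h2
    exact h2
  -- the incidence equation: `Σᵢ ρ(x_i/x_j) κ(aᵢ/a_l) = pull χ g = 0`
  have hsum : ∑ i, Segre.pull (χ ≫ chartα e.ι j l X' hX') (Segre.frac ℂ j i) *
      Segre.pull (((fiberι (proj e.n e.ι) (ProjectiveSpace.pointOfVec ℂ a ha) ≫ toX e.n e.ι).left ⁻¹ᵁ
          (X' : X.left.Opens)).ι ≫
        (fiberOverToSpec (proj e.n e.ι) (ProjectiveSpace.pointOfVec ℂ a ha)).left) (a i / a l) = 0 := by
    rw [← hχ0, incidenceFun, map_sum (Segre.pull χ)]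
    refine Finset.sum_congr rfl fun i _ => ?_
    rw [← hu, ← hv, ← map_mul (Segre.pull χ), Algebra.TensorProduct.tmul_mul_tmul, mul_one, one_mul]
  -- dehomogenisation: `ℓ_a/x_j = Σᵢ cst(aᵢ) · x_i/x_j`
  have hlin : Away.mk 𝒜ₑ (Segre.X_mem ℂ j) 1 (linForm e.n a) hmem =
      ∑ i, Segre.cst ℂ (MvPolynomial.X j) (a i) * Segre.frac ℂ j i := by
    rw [Segre.awayMk_eq_eval₂, linForm, map_sum (MvPolynomial.eval₂Hom _ _)]
    refine Finset.sum_congr rfl fun i _ => ?_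
    rw [map_mul, MvPolynomial.eval₂Hom_C, MvPolynomial.eval₂Hom_X']
  -- assemble
  have key : Segre.pull (χ ≫ chartα e.ι j l X' hX') (Away.mk 𝒜ₑ (Segre.X_mem ℂ j) 1 (linForm e.n a) hmem) = 0 := by
    rw [hlin, map_sum (Segre.pull (χ ≫ chartα e.ι j l X' hX'))]
    have hterm : ∀ i, Segre.pull (χ ≫ chartα e.ι j l X' hX') (Segre.cst ℂ (MvPolynomial.X j) (a i) * Segre.frac ℂ j i) =
        Segre.pull (((fiberι (proj e.n e.ι) (ProjectiveSpace.pointOfVec ℂ a ha) ≫ toX e.n e.ι).left ⁻¹ᵁ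
            (X' : X.left.Opens)).ι ≫
            (fiberOverToSpec (proj e.n e.ι) (ProjectiveSpace.pointOfVec ℂ a ha)).left) (a l) *
          (Segre.pull (χ ≫ chartα e.ι j l X' hX') (Segre.frac ℂ j i) *
            Segre.pull (((fiberι (proj e.n e.ι) (ProjectiveSpace.pointOfVec ℂ a ha) ≫ toX e.n e.ι).left ⁻¹ᵁ
              (X' : X.left.Opens)).ι ≫
              (fiberOverToSpec (proj e.n e.ι) (ProjectiveSpace.pointOfVec ℂ a ha)).left) (a i / a l)) := by
      intro i
      have hai : a i = a l * (a i / a l) := (mul_div_cancel₀ (a i) hl).symm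
      rw [map_mul, hcst]
      conv_lhs => rw [hai]
      rw [map_mul]
      ring
    rw [Finset.sum_congr rfl fun i _ => hterm i, ← Finset.mul_sum, hsum, mul_zero]
  have hpull : Segre.pull (χ ≫ chartα e.ι j l X' hX') =
      (((fiberι (proj e.n e.ι) (ProjectiveSpace.pointOfVec ℂ a ha) ≫ toX e.n e.ι).left ∣_
        (X' : X.left.Opens)).appTop.hom.comp
        (Segre.pull (X.left.homOfLE hX' ≫ GeneratingSections.chartLift e.toProj j))) := by
    rw [hB, Segre.pull_comp]
  rw [hpull, RingHom.comp_apply] at key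
  exact key

/-- `π⁻¹[a] ⟶ 𝒳 ⟶ X × (ℙᴺ)^*` is `(π⁻¹[a] ⟶ X) ≫ (slice at [a])`. [folklore] -/
private theorem fiberι_proj_emb_eq_sliceAt :
    fiberι (proj e.n e.ι) (ProjectiveSpace.pointOfVec ℂ a ha) ≫ emb e.n e.ι =
      (fiberι (proj e.n e.ι) (ProjectiveSpace.pointOfVec ℂ a ha) ≫ toX e.n e.ι) ≫
        sliceAt X (ProjectiveSpace.pointOfVec ℂ a ha) := by
  apply CartesianMonoidalCategory.hom_ext
  · rw [Category.assoc, Category.assoc, sliceAt_fst, Category.comp_id]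
    rfl
  · rw [Category.assoc, Category.assoc, sliceAt_snd, ← Category.assoc _ (toSpecOver X),
      eq_toSpecOver_of_hom ((fiberι _ _ ≫ toX e.n e.ι) ≫ toSpecOver X),
      ← eq_toSpecOver_of_hom (fiberOverToSpec _ _), ← fiberι_comp]
    rfl

/-- **`π⁻¹[a] ⟶ X` is a closed immersion**: `π⁻¹[a] ⟶ 𝒳 ⟶ X × (ℙᴺ)^*` is one and factors through
the closed immersion `X ≅ X × {[a]} ⟶ X × (ℙᴺ)^*`. [cite: VoisinHodgeII2003, §2.3.1] -/
theorem isClosedImmersion_fiberι_proj_toX_left [LocallyOfFiniteType X.hom] :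
    IsClosedImmersion (fiberι (proj e.n e.ι) (ProjectiveSpace.pointOfVec ℂ a ha) ≫ toX e.n e.ι).left := by
  haveI : IsSeparated (dualProjectiveSpace e.n ℂ).hom := inferInstance
  haveI := isClosedImmersion_fiberι_left (proj e.n e.ι) (ProjectiveSpace.pointOfVec ℂ a ha)
  haveI : IsClosedImmersion (sliceAt X (ProjectiveSpace.pointOfVec ℂ a ha)).left :=
    isClosedImmersion_sliceAt_left _
  haveI : IsClosedImmersion ((fiberι (proj e.n e.ι) (ProjectiveSpace.pointOfVec ℂ a ha) ≫ toX e.n e.ι).left ≫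
      (sliceAt X (ProjectiveSpace.pointOfVec ℂ a ha)).left) := by
    rw [← Over.comp_left, ← fiberι_proj_emb_eq_sliceAt, Over.comp_left]
    infer_instance
  exact IsClosedImmersion.of_comp_isClosedImmersion _ (sliceAt X (ProjectiveSpace.pointOfVec ℂ a ha)).left

/-- **The generators of the zero-scheme ideal of `ℓ_a(s)` die on `π⁻¹[a]`**: on the chart `X_{x_j}`
of `e`, the chart value `ℓ_a(s)/s_j ∈ Γ(X, X_{x_j})` maps to `0` in `Γ(π⁻¹[a], (π⁻¹[a] ⟶ X)⁻¹ X_{x_j})`.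
[cite: GortzWedhorn2020, Section (13.13)] -/
theorem app_secOfForm_linForm_val_eq_zero (j : Fin (e.n + 1)) :
    (fiberι (proj e.n e.ι) (ProjectiveSpace.pointOfVec ℂ a ha) ≫ toX e.n e.ι).left.app
        ((GeneratingSections.ofHom e.toProj).U j)
      ((e.secOfForm (linForm e.n a) (isHomogeneous_linForm e.n a)).val j) = 0 := by
  have hmem : linForm e.n a ∈ 𝒜ₑ (1 • 1) := by simpa using isHomogeneous_linForm e.n a
  have hval : (e.secOfForm (linForm e.n a) (isHomogeneous_linForm e.n a)).val j =
      (e.toProj ⁻¹ᵁ Proj.basicOpen 𝒜ₑ (MvPolynomial.X j)).topIso.hom.hom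
        (Segre.pull (GeneratingSections.chartLift e.toProj j) (Away.mk 𝒜ₑ (Segre.X_mem ℂ j) 1 (linForm e.n a) hmem)) := by
    change ((GeneratingSections.ofHom e.toProj).secOfForm X.hom (linForm e.n a) (isHomogeneous_linForm e.n a)).val j = _
    rw [GeneratingSections.secOfForm_val,
      GeneratingSections.sectionsFun_ofHom_eq X.hom e.toProj (toProj_toSpec e) j (linForm e.n a) hmem]
  have h0 := appTop_restrict_pull_chartLift_linForm e a ha j
    ⟨e.toProj ⁻¹ᵁ Proj.basicOpen 𝒜ₑ (MvPolynomial.X j), GeneratingSections.isAffineOpen_ofHom_U' e.toProj j⟩ le_rfl hmem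
  have hid : X.left.homOfLE (le_rfl : e.toProj ⁻¹ᵁ Proj.basicOpen 𝒜ₑ (MvPolynomial.X j) ≤
      e.toProj ⁻¹ᵁ Proj.basicOpen 𝒜ₑ (MvPolynomial.X j)) = 𝟙 _ := Scheme.homOfLE_rfl _ _
  change ((fiberι (proj e.n e.ι) (ProjectiveSpace.pointOfVec ℂ a ha) ≫ toX e.n e.ι).left ∣_
      (e.toProj ⁻¹ᵁ Proj.basicOpen 𝒜ₑ (MvPolynomial.X j))).appTop
      (Segre.pull (X.left.homOfLE le_rfl ≫ GeneratingSections.chartLift e.toProj j)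
        (Away.mk 𝒜ₑ (Segre.X_mem ℂ j) 1 (linForm e.n a) hmem)) = 0 at h0
  rw [hid, Category.id_comp, morphismRestrict_appTop_apply] at h0
  have h1 := congrArg (fun y => ((fiberι (proj e.n e.ι) (ProjectiveSpace.pointOfVec ℂ a ha) ≫ toX e.n e.ι).left ⁻¹ᵁ
    (e.toProj ⁻¹ᵁ Proj.basicOpen 𝒜ₑ (MvPolynomial.X j))).topIso.hom y) h0
  dsimp only at h1
  rw [← CommRingCat.comp_apply, Iso.inv_hom_id, map_zero, CommRingCat.id_apply] at h1
  rw [hval]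
  exact h1

/-- **The zero-scheme ideal of `ℓ_a(s)` is contained in the kernel of `π⁻¹[a] ⟶ X`** (checked on
the affine cover of `X` by the charts `X_{x_j}` of `e`, where it is generated by `ℓ_a(s)/s_j`).
[cite: GortzWedhorn2020, Remark 11.27 and Section (13.13)] -/
theorem zeroIdeal_secOfForm_linForm_le_ker :
    (e.secOfForm (linForm e.n a) (isHomogeneous_linForm e.n a)).zeroIdeal ≤
      (fiberι (proj e.n e.ι) (ProjectiveSpace.pointOfVec ℂ a ha) ≫ toX e.n e.ι).left.ker := by
  haveI : QuasiSeparatedSpace X.left := quasiSeparatedSpace_of_quasiSeparated e.toProj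
  haveI : LocallyOfFiniteType X.hom := by rw [← Over.w e.ι]; infer_instance
  haveI := isClosedImmersion_fiberι_proj_toX_left e a ha
  refine Scheme.IdealSheafData.le_of_iSup_eq_top
    (fun j => ⟨(GeneratingSections.ofHom e.toProj).U j, GeneratingSections.isAffineOpen_ofHom_U' e.toProj j⟩)
    (GeneratingSections.ofHom e.toProj).iSup_U fun j => ?_
  rw [(e.secOfForm (linForm e.n a) (isHomogeneous_linForm e.n a)).ideal_zeroIdeal_self
      (GeneratingSections.isAffineOpen_ofHom_U' e.toProj) j, Scheme.Hom.ker_apply, Ideal.span_le,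
    Set.singleton_subset_iff]
  exact app_secOfForm_linForm_val_eq_zero e a ha j

/-- **The morphism `π⁻¹[a] ⟶ X ∩ V₊(ℓ_a)` over `X`**: the universal property of the closed immersion
`X ∩ V₊(ℓ_a) ↪ X` (Mathlib `IsClosedImmersion.lift`) applied to `π⁻¹[a] ⟶ X`, whose kernel contains
the zero-scheme ideal. [cite: VoisinHodgeII2003, §2.3.1] [cite: GortzWedhorn2020, Section (13.13)] -/
theorem exists_hom_fiberOver_proj_hypersurfaceSection :
    ∃ w : fiberOver (proj e.n e.ι) (ProjectiveSpace.pointOfVec ℂ a ha) ⟶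
        e.hypersurfaceSection (linForm e.n a) (isHomogeneous_linForm e.n a),
      w ≫ e.hypersurfaceSectionι (linForm e.n a) (isHomogeneous_linForm e.n a) =
        fiberι (proj e.n e.ι) (ProjectiveSpace.pointOfVec ℂ a ha) ≫ toX e.n e.ι := by
  have hle : (e.hypersurfaceSectionι (linForm e.n a) (isHomogeneous_linForm e.n a)).left.ker ≤
      (fiberι (proj e.n e.ι) (ProjectiveSpace.pointOfVec ℂ a ha) ≫ toX e.n e.ι).left.ker := by
    have hk : (e.hypersurfaceSectionι (linForm e.n a) (isHomogeneous_linForm e.n a)).left.ker =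
        (e.secOfForm (linForm e.n a) (isHomogeneous_linForm e.n a)).zeroIdeal :=
      Scheme.IdealSheafData.ker_subschemeι _
    rw [hk]
    exact zeroIdeal_secOfForm_linForm_le_ker e a ha
  refine ⟨Over.homMk (IsClosedImmersion.lift _ _ hle) ?_, ?_⟩
  · change IsClosedImmersion.lift _ _ hle ≫ (e.hypersurfaceSectionι (linForm e.n a) (isHomogeneous_linForm e.n a)).left ≫
      X.hom = _
    rw [IsClosedImmersion.lift_fac_assoc]
    exact Over.w _
  · ext : 1
    exact IsClosedImmersion.lift_fac _ _ hle

/-! ### The two avatars have the same complex points; the isomorphism -/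

/-- `ℓ_a(z) = Σᵢ aᵢ zᵢ`. [folklore] -/
private theorem aeval_linForm_eq (z : Fin (e.n + 1) → ℂ) :
    MvPolynomial.aeval z (linForm e.n a) = ∑ i, a i * z i := by
  simp [linForm, map_sum]

/-- **A complex point `x` of `X` lies on `X ∩ V₊(ℓ_a)` iff `ℓ_a(e(x)) = 0`.**
[cite: GortzWedhorn2020, Section (13.13), p. 505] -/
theorem mem_range_map_hypersurfaceSectionι_linForm_iff (x : ComplexPoints X) (z : Fin (e.n + 1) → ℂ) (hz : z ≠ 0)
    (hx : AlgPoints.map e.ι x = ProjectiveSpace.pointOfVec ℂ z hz) :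
    x ∈ Set.range (AlgPoints.map (L := ℂ) (e.hypersurfaceSectionι (linForm e.n a) (isHomogeneous_linForm e.n a))) ↔
      ∑ i, a i * z i = 0 := by
  haveI : QuasiSeparatedSpace X.left := quasiSeparatedSpace_of_quasiSeparated e.toProj
  rw [AlgPoints.mem_range_map_iff_pt_mem, hypersurfaceSectionι_left, ← hypersurfaceSectionι_left,
    range_hypersurfaceSectionι e (linForm e.n a) (isHomogeneous_linForm e.n a) one_pos, Set.mem_preimage]
  have hpt : e.toProj x.pt = (ProjectiveSpace.pointOfVec ℂ z hz).pt := by rw [← hx]; rfl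
  rw [hpt]
  exact (ProjectiveSpace.pt_pointOfVec_mem_zeroLocus_iff z hz one_pos (linForm_mem e.n a)).trans
    (by rw [aeval_linForm_eq])

/-- **Every complex point of `X ∩ V₊(ℓ_a)` is a complex point of `π⁻¹[a]`** (in `X`): for `x ∈ X(ℂ)`
with `ℓ_a(e(x)) = 0` the point `(x, [a])` of `X × (ℙᴺ)^*` lies on the incidence locus, lifts to `𝒳`
and then to the fibre `π⁻¹[a]`. [cite: VoisinHodgeII2003, §3.2.2] -/
theorem range_map_hypersurfaceSectionι_subset_range_map_fiberι_proj_toX :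
    Set.range (AlgPoints.map (L := ℂ) (e.hypersurfaceSectionι (linForm e.n a) (isHomogeneous_linForm e.n a))) ⊆
      Set.range (AlgPoints.map (L := ℂ) (fiberι (proj e.n e.ι) (ProjectiveSpace.pointOfVec ℂ a ha) ≫ toX e.n e.ι)) := by
  intro x hx
  obtain ⟨z, hz, hxz⟩ := ProjectiveSpace.exists_eq_pointOfVec (AlgPoints.map e.ι x)
  have hinc : ∑ i, z i * a i = 0 := by
    rw [← (mem_range_map_hypersurfaceSectionι_linForm_iff e a x z hz hxz).1 hx]
    exact Finset.sum_congr rfl fun i _ => mul_comm _ _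
  -- the point `(x, [a])` of `X × (ℙᴺ)^*` lies on `𝒳`
  have hP : AlgPoints.pt (CartesianMonoidalCategory.lift x (ProjectiveSpace.pointOfVec ℂ a ha) :
      ComplexPoints (X ⊗ dualProjectiveSpace e.n ℂ)) ∈ Set.range (emb e.n e.ι).left := by
    rw [range_emb]
    exact (ProjectiveSpace.pt_lift_mem_incidenceLocus_iff e.ι x hz hxz ha).2 hinc
  set y := AlgPoints.liftClosed (emb e.n e.ι) _ hP with hy
  have hy' : AlgPoints.map (emb e.n e.ι) y = CartesianMonoidalCategory.lift x (ProjectiveSpace.pointOfVec ℂ a ha) :=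
    AlgPoints.map_liftClosed _ _ hP
  have hyproj : y ≫ proj e.n e.ι = ProjectiveSpace.pointOfVec ℂ a ha := by
    change AlgPoints.map (emb e.n e.ι) y ≫ snd X (dualProjectiveSpace e.n ℂ) = _
    rw [hy', CartesianMonoidalCategory.lift_snd]
  have hyX : y ≫ toX e.n e.ι = x := by
    change AlgPoints.map (emb e.n e.ι) y ≫ fst X (dualProjectiveSpace e.n ℂ) = _
    rw [hy', CartesianMonoidalCategory.lift_fst]
  -- lift to the fibre
  have hw : y.left ≫ (proj e.n e.ι).left = 𝟙 _ ≫ (ProjectiveSpace.pointOfVec ℂ a ha).left := by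
    rw [Category.id_comp, ← Over.comp_left, hyproj]
  let q : ComplexPoints (fiberOver (proj e.n e.ι) (ProjectiveSpace.pointOfVec ℂ a ha)) :=
    Over.homMk (pullback.lift y.left (𝟙 _) hw) (by
      change pullback.lift y.left (𝟙 _) hw ≫ pullback.fst _ _ ≫ (universalHyperplaneSection e.n e.ι).hom = _
      rw [pullback.lift_fst_assoc]
      exact Over.w y)
  refine ⟨q, ?_⟩
  rw [AlgPoints.map_apply, ← hyX]
  ext : 1
  change (pullback.lift y.left (𝟙 _) hw ≫ pullback.fst _ _) ≫ (toX e.n e.ι).left = y.left ≫ (toX e.n e.ι).left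
  rw [pullback.lift_fst]

/-- **Both avatars have the same complex points in `X`.** [cite: VoisinHodgeII2003, §2.3.1] -/
theorem range_map_fiberι_proj_toX_eq :
    Set.range (AlgPoints.map (L := ℂ) (fiberι (proj e.n e.ι) (ProjectiveSpace.pointOfVec ℂ a ha) ≫ toX e.n e.ι)) =
      Set.range (AlgPoints.map (L := ℂ) (e.hypersurfaceSectionι (linForm e.n a) (isHomogeneous_linForm e.n a))) := by
  refine Set.Subset.antisymm ?_ (range_map_hypersurfaceSectionι_subset_range_map_fiberι_proj_toX e a ha)
  obtain ⟨w, hw⟩ := exists_hom_fiberOver_proj_hypersurfaceSection e a ha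
  rintro _ ⟨q, rfl⟩
  exact ⟨AlgPoints.map w q, by rw [← AlgPoints.map_comp_apply, hw]⟩

/-- **The fibre of the universal hyperplane section over `[a]` IS the hyperplane section
`X ∩ V₊(ℓ_a)`** when the latter is reduced (e.g. smooth): the morphism `π⁻¹[a] ⟶ X ∩ V₊(ℓ_a)` over `X`
is a surjective closed immersion onto a reduced scheme, hence an isomorphism.
[cite: VoisinHodgeII2003, §2.3.1] [cite: Hartshorne1977, II Example 3.2.6] -/
theorem exists_iso_fiberOver_proj_hypersurfaceSection
    [IsReduced (e.hypersurfaceSection (linForm e.n a) (isHomogeneous_linForm e.n a)).left] :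
    ∃ φ : fiberOver (proj e.n e.ι) (ProjectiveSpace.pointOfVec ℂ a ha) ≅
        e.hypersurfaceSection (linForm e.n a) (isHomogeneous_linForm e.n a),
      φ.hom ≫ e.hypersurfaceSectionι (linForm e.n a) (isHomogeneous_linForm e.n a) =
        fiberι (proj e.n e.ι) (ProjectiveSpace.pointOfVec ℂ a ha) ≫ toX e.n e.ι := by
  obtain ⟨w, hw⟩ := exists_hom_fiberOver_proj_hypersurfaceSection e a ha
  haveI : LocallyOfFiniteType X.hom := by rw [← Over.w e.ι]; infer_instance
  haveI hu := isClosedImmersion_fiberι_proj_toX_left e a ha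
  haveI : IsClosedImmersion (w.left ≫ (e.hypersurfaceSectionι (linForm e.n a) (isHomogeneous_linForm e.n a)).left) := by
    rw [← Over.comp_left, hw]
    exact hu
  haveI hwc : IsClosedImmersion w.left :=
    IsClosedImmersion.of_comp_isClosedImmersion _ (e.hypersurfaceSectionι (linForm e.n a) (isHomogeneous_linForm e.n a)).left
  -- surjectivity, from the complex points
  have hsub := SectionFamily.range_left_subset_of_range_map_subset
    (e.hypersurfaceSectionι (linForm e.n a) (isHomogeneous_linForm e.n a))
    (fiberι (proj e.n e.ι) (ProjectiveSpace.pointOfVec ℂ a ha) ≫ toX e.n e.ι)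
    (range_map_hypersurfaceSectionι_subset_range_map_fiberι_proj_toX e a ha)
  have hsurj : Function.Surjective w.left.base := by
    intro p
    obtain ⟨q, hq⟩ := hsub ⟨p, rfl⟩
    refine ⟨q, (e.hypersurfaceSectionι (linForm e.n a) (isHomogeneous_linForm e.n a)).left.isClosedEmbedding.injective ?_⟩
    rw [← Scheme.Hom.comp_apply, ← Over.comp_left, hw]
    exact hq
  have hker : w.left.ker = ⊥ := by
    rw [← Scheme.IdealSheafData.support_eq_top_iff]
    apply le_antisymm le_top
    intro p _
    have hp : p ∈ (w.left.ker.support : Set _) := by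
      rw [Scheme.Hom.support_ker]
      exact subset_closure (hsurj p)
    exact hp
  haveI : IsIso w.left := IsClosedImmersion.isIso_iff_ker_eq_bot.mpr hker
  haveI : IsIso ((Over.forget _).map w) := inferInstanceAs (IsIso w.left)
  haveI : IsIso w := isIso_of_reflects_iso w (Over.forget _)
  exact ⟨asIso w, hw⟩

/-- **Smoothness, projectivity and irreducibility of the hyperplane section `X ∩ V₊(ℓ_a)` are those
of the fibre `π⁻¹[a]`**: if `X ∩ V₊(ℓ_a)` is a smooth projective variety of dimension `n`, so is the
fibre of the universal hyperplane section over `[a]` (transport along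
`exists_iso_fiberOver_proj_hypersurfaceSection`; a smooth `ℂ`-scheme is reduced).
[cite: VoisinHodgeII2003, §2.3.1 and §3.2.2] -/
theorem isSmoothProjective_fiberOver_proj_of_hypersurfaceSection {n : ℕ}
    (h : IsSmoothProjective n (e.hypersurfaceSection (linForm e.n a) (isHomogeneous_linForm e.n a))) :
    IsSmoothProjective n (fiberOver (proj e.n e.ι) (ProjectiveSpace.pointOfVec ℂ a ha)) := by
  haveI := h.smoothOfRelativeDimension
  haveI : Smooth (e.hypersurfaceSection (linForm e.n a) (isHomogeneous_linForm e.n a)).hom :=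
    SmoothOfRelativeDimension.smooth n _
  haveI : IsReduced (e.hypersurfaceSection (linForm e.n a) (isHomogeneous_linForm e.n a)).left :=
    isReduced_of_smooth_over_field (e.hypersurfaceSection (linForm e.n a) (isHomogeneous_linForm e.n a)).hom
  obtain ⟨φ, -⟩ := exists_iso_fiberOver_proj_hypersurfaceSection e a ha
  exact h.of_iso φ.symm


/-- The isomorphism `π⁻¹[a] ≅ X ∩ V₊(ℓ_a)` over `X` for a SMOOTH hyperplane section (a smooth
`ℂ`-scheme is reduced). [cite: VoisinHodgeII2003, §2.3.1] -/
theorem exists_iso_fiberOver_proj_hypersurfaceSection_of_isSmoothProjective {n : ℕ}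
    (h : IsSmoothProjective n (e.hypersurfaceSection (linForm e.n a) (isHomogeneous_linForm e.n a))) :
    ∃ φ : fiberOver (proj e.n e.ι) (ProjectiveSpace.pointOfVec ℂ a ha) ≅
        e.hypersurfaceSection (linForm e.n a) (isHomogeneous_linForm e.n a),
      φ.hom ≫ e.hypersurfaceSectionι (linForm e.n a) (isHomogeneous_linForm e.n a) =
        fiberι (proj e.n e.ι) (ProjectiveSpace.pointOfVec ℂ a ha) ≫ toX e.n e.ι := by
  haveI := h.smoothOfRelativeDimension
  haveI : Smooth (e.hypersurfaceSection (linForm e.n a) (isHomogeneous_linForm e.n a)).hom :=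
    SmoothOfRelativeDimension.smooth n _
  haveI : IsReduced (e.hypersurfaceSection (linForm e.n a) (isHomogeneous_linForm e.n a)).left :=
    isReduced_of_smooth_over_field (e.hypersurfaceSection (linForm e.n a) (isHomogeneous_linForm e.n a)).hom
  exact exists_iso_fiberOver_proj_hypersurfaceSection e a ha

end Fibre

end UniversalHyperplaneSection

end Literature.AlgebraicGeometry.Motives

end
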